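import Summits.AtomisticToContinuum.Crystallization.Theorems.FrustratedLawDichotomyCollarCensus

/-!
# FrustratedLawDichotomy · crux `AperiodicFrustratedLawGap` (stmt-AtomisticToContinuum-27623) — the collared census node with the BAD-SITE LEVY
# `κ_T` AS A PARAMETER (decomp-a2c, prover hand 2, generation 16; critic row 585 (C)(4): margin watch / pre-emptive re-file rule at `κ_T = 1/125`)

The T-side leaf line of record (`…CollarCensus.aperiodicFrustratedLawGap_of_collarPieces_record`) carries the literal `κ_T = 1/100` from
`…AveragingRuleTightFree.surplusCap_ge` upward (absorption lemmas of `…ExemptAbsorption` §3, the census object and pieces of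
`…ExemptAbsorptionRecord` §4, the bridges of `…CollarCensus` §2–§3, `…OptimalityCut.ToptFourHalf`), whereas the DOOR is generic:
`…ExemptSplit.aperiodicFrustratedLawGap_of_split_locOpt_fourHalf` holds for every `κ_T > 0`.  This file re-types that column ONCE with `κ_T` as a
parameter (`0 ≤ κ_T ≤ 1` — the `+1` in `Dfl` absorbs the levy), so that a re-file at any smaller literal is an instantiation, not a re-typing:

* §1 κ-generic absorption: `surplusCap_ge_kappa`, `…_of_good_kappa`, `surplusCapX_ge_kappa(_of_exempt/_of_good)`, `exemptAbsorptionCapX_kappa`,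
  `tightAbsorptionCapX_kappa`, `ballAvg_surplusCapX_eq_of_free_kappa`;
* §2 `EquilibriumMotifPricingCapK κ_T …` and the three pieces `StrainedPatchMotifPricingCapXK` / `CrowdedCoreMotifPricingCapK` /
  `DiluteDefectMotifPricingCapK` (at `κ_T = 1/100` they ARE the record predicates: `…_centi`, `Iff.rfl`), the case split `…K_iff_pieces`, and
  ★ MONOTONICITY IN THE LEVY `equilibriumMotifPricingCapK_anti_kappa` (a smaller levy gives a WEAKER census object);
* §3 bridges `ballAveragedMotifPricingCapX_of_equilibriumK`, `schurTopologicalPricingX_of_collarMotifCapK`, and ★★ the node BY NAME for every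
  `0 < κ_T ≤ 1`: `aperiodicFrustratedLawGap_of_collarMotifCapK` / `…_of_collarPiecesK_record` (all other literals as in the record);
* §4 both levies as parameters (`0 < κ_E`, raw E-side hypothesis): `…_of_collarMotifCapKK` / `…_of_collarPiecesKK_record`.
All `[folklore]` bookkeeping; 0 sorry.
-/

noncomputable section

namespace Summit.AtomisticToContinuum.Crystallization.Theorems.FrustratedLawDichotomyCollarCensusKappa

open scoped BigOperators Classical
open Literature.MathematicalPhysics.StatisticalMechanics (interactionEnergy siteEnergy lennardJones)
open Summit.AtomisticToContinuum.Crystallization.Theorems.ChargedEnergyGapNegative (E3 eStar)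
open Summit.AtomisticToContinuum.Crystallization.Theorems.FrustratedLawDichotomyRangeCut
open Summit.AtomisticToContinuum.Crystallization.Theorems.FrustratedLawDichotomySchurCut
open Summit.AtomisticToContinuum.Crystallization.Theorems.FrustratedLawDichotomyMotifLemmas
open Summit.AtomisticToContinuum.Crystallization.Theorems.FrustratedLawDichotomyRuleToolkit
open Summit.AtomisticToContinuum.Crystallization.Theorems.FrustratedLawDichotomyRuleToolkitGood
open Summit.AtomisticToContinuum.Crystallization.Theorems.FrustratedLawDichotomyAveragingCut
  (surplus ball ballAvg mem_ball card_ball_pos one_le_card_ball card_ball_le sum_ballAvg sum_surplus BallAveragedPricing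
   CutBounds Mball one_le_Mball Dfl Dfl_pos CT₀ Dfl_le_CT₀ siteEnergy_ge sum_div_ge_of_one_large W₄₅ e₄₅ CT₄₅ W₄₅_cutBounds)
open Summit.AtomisticToContinuum.Crystallization.Theorems.FrustratedLawDichotomyAveragingRule
open Summit.AtomisticToContinuum.Crystallization.Theorems.FrustratedLawDichotomyAveragingRuleCap
open Summit.AtomisticToContinuum.Crystallization.Theorems.FrustratedLawDichotomyAveragingRuleTightFree
open Summit.AtomisticToContinuum.Crystallization.Theorems.FrustratedLawDichotomyExemptDoor (SitePred)
open Summit.AtomisticToContinuum.Crystallization.Theorems.FrustratedLawDichotomyExemptLocOpt (LocOpt LocOptFails)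
open Summit.AtomisticToContinuum.Crystallization.Theorems.FrustratedLawDichotomyExemptSplit
  (SchurTopologicalPricingX SchurElasticPricingX aperiodicFrustratedLawGap_of_split_locOpt_fourHalf)
open Summit.AtomisticToContinuum.Crystallization.Theorems.FrustratedLawDichotomyOptimalityCut (EoptFourHalf)
open Summit.AtomisticToContinuum.Crystallization.Theorems.FrustratedLawDichotomyBumpAutocorrelation (sf₄₅_holds)
open Summit.AtomisticToContinuum.Crystallization.Theorems.FrustratedLawDichotomyExemptAbsorption
open Summit.AtomisticToContinuum.Crystallization.Theorems.FrustratedLawDichotomyExemptAbsorptionRecord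
open Summit.AtomisticToContinuum.Crystallization.Theorems.FrustratedLawDichotomyCollarCensus

/-! ## §1. Absorption with a general levy `0 ≤ κ_T ≤ 1` -/

/-- Capped surplus floor with a general levy: `x_j ≥ −Dfl R B e` (`C_T ≥ 0`, `0 ≤ κ_T ≤ 1`; the `+1` of `Dfl` absorbs the levy). [folklore] -/
theorem surplusCap_ge_kappa {W : ℝ → ℝ} {R B e CT D κT : ℝ} (hW : CutBounds W R B) (hCT : 0 ≤ CT) (hκ0 : 0 ≤ κT) (hκ1 : κT ≤ 1) {N : ℕ}
    {y : Fin N → E3} (hs : Sep y) (j : Fin N) : -Dfl R B e ≤ surplusCap (1 / 20) (1 / 8) D W e κT CT N y j := by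
  have h := siteEnergy_ge hW hs j
  have hsite : (pairSumFeature W N y j - W 0) / 2 = siteEnergy W y j / 2 := by
    unfold pairSumFeature; rw [siteEnergy_eq]
  unfold surplusCap
  rw [hsite]
  unfold Dfl
  have hg1 := goodFlag_mem (η := 1 / 8) (D := D) y j
  have hg0 := goodFlag_mem (η := 1 / 20) (D := D) y j
  have hlevy : κT * (1 - goodFlag (1 / 8) D N y j) ≤ 1 := by nlinarith [hg1.1, hg1.2]
  nlinarith [le_abs_self e, mul_nonneg hCT hg0.1]

/-- A capped-tightly-good site carries `x_j ≥ C_T − Dfl R B e` (general levy `0 ≤ κ_T ≤ 1`). [folklore] -/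
theorem surplusCap_ge_of_good_kappa {W : ℝ → ℝ} {R B e CT D κT : ℝ} (hW : CutBounds W R B) (hκ0 : 0 ≤ κT) (hκ1 : κT ≤ 1) {N : ℕ}
    {y : Fin N → E3} (hs : Sep y) {j : Fin N} (hg : GoodAtScale (1 / 20) D y j) :
    CT - Dfl R B e ≤ surplusCap (1 / 20) (1 / 8) D W e κT CT N y j := by
  have h := siteEnergy_ge hW hs j
  have hsite : (pairSumFeature W N y j - W 0) / 2 = siteEnergy W y j / 2 := by
    unfold pairSumFeature; rw [siteEnergy_eq]
  unfold surplusCap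
  rw [hsite]
  unfold Dfl
  have hg1 := goodFlag_mem (η := 1 / 8) (D := D) y j
  have hflag : goodFlag (1 / 20) D N y j = 1 := by unfold goodFlag; rw [if_pos hg]
  rw [hflag]
  have hlevy : κT * (1 - goodFlag (1 / 8) D N y j) ≤ 1 := by nlinarith [hg1.1, hg1.2]
  nlinarith [le_abs_self e]

/-- X-surplus floor with a general levy. [folklore] -/
theorem surplusCapX_ge_kappa {W : ℝ → ℝ} {R B e CT DT D κT : ℝ} {ExM : SitePred} (hW : CutBounds W R B) (hCT : 0 ≤ CT) (hDT : 0 ≤ DT)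
    (hκ0 : 0 ≤ κT) (hκ1 : κT ≤ 1) {N : ℕ} {y : Fin N → E3} (hs : Sep y) (j : Fin N) :
    -Dfl R B e ≤ surplusCapX (1 / 20) (1 / 8) D W e κT CT DT ExM N y j :=
  (surplusCap_ge_kappa hW hCT hκ0 hκ1 hs j).trans (surplusCap_le_surplusCapX hDT y j)

/-- An exempt site carries `x^X_j ≥ D_T − Dfl` (general levy). [folklore] -/
theorem surplusCapX_ge_of_exempt_kappa {W : ℝ → ℝ} {R B e CT DT D κT : ℝ} {ExM : SitePred} (hW : CutBounds W R B) (hCT : 0 ≤ CT)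
    (hκ0 : 0 ≤ κT) (hκ1 : κT ≤ 1) {N : ℕ} {y : Fin N → E3} (hs : Sep y) {j : Fin N} (hx : ExM N y j) :
    DT - Dfl R B e ≤ surplusCapX (1 / 20) (1 / 8) D W e κT CT DT ExM N y j := by
  have h := surplusCap_ge_kappa (e := e) (D := D) hW hCT hκ0 hκ1 hs j
  unfold surplusCapX
  rw [flag_eq_one hx]
  linarith

/-- A capped-tightly-good site carries `x^X_j ≥ C_T − Dfl` (general levy, `D_T ≥ 0`). [folklore] -/
theorem surplusCapX_ge_of_good_kappa {W : ℝ → ℝ} {R B e CT DT D κT : ℝ} {ExM : SitePred} (hW : CutBounds W R B) (hDT : 0 ≤ DT)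
    (hκ0 : 0 ≤ κT) (hκ1 : κT ≤ 1) {N : ℕ} {y : Fin N → E3} (hs : Sep y) {j : Fin N} (hg : GoodAtScale (1 / 20) D y j) :
    CT - Dfl R B e ≤ surplusCapX (1 / 20) (1 / 8) D W e κT CT DT ExM N y j :=
  (surplusCap_ge_of_good_kappa hW hκ0 hκ1 hs hg).trans (surplusCap_le_surplusCapX hDT y j)

/-- ★ Exempt absorption with a general levy (`D_T ≥ C_T⁰(R, B, e, ρ)`, `C_T ≥ 0`, `ρ ≥ 0`). [folklore] -/
theorem exemptAbsorptionCapX_kappa {W : ℝ → ℝ} {R B e ρ CT DT D κT : ℝ} {ExM : SitePred} (hW : CutBounds W R B) (hρ : 0 ≤ ρ)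
    (hCT : 0 ≤ CT) (hDT : CT₀ R B e ρ ≤ DT) (hκ0 : 0 ≤ κT) (hκ1 : κT ≤ 1) {N : ℕ} {y : Fin N → E3} (hs : Sep y) {i : Fin N}
    (hX : ExemptNear ρ ExM y i) : 0 ≤ ballAvg ρ y (surplusCapX (1 / 20) (1 / 8) D W e κT CT DT ExM N y) i := by
  obtain ⟨a, ha, hxa⟩ := hX
  have hD : 0 ≤ Dfl R B e := (Dfl_pos hW.range_nonneg hW.floor_nonneg).le
  have hDC := Dfl_le_CT₀ (e := e) hW.range_nonneg hW.floor_nonneg ρ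
  have hDT0 : 0 ≤ DT := le_trans hD (hDC.trans hDT)
  have hM1 := one_le_Mball hρ
  have key := sum_div_ge_of_one_large (ball ρ y i) ha (surplusCapX (1 / 20) (1 / 8) D W e κT CT DT ExM N y)
    (fun j => ((ball ρ y j).card : ℝ)) (L := DT - Dfl R B e) (M := Mball ρ) (D := Dfl R B e) (by linarith) hD
    (fun j _ => by exact_mod_cast one_le_card_ball hρ y j) (card_ball_le hρ hs a) (card_ball_le hρ hs i)
    (fun j _ => surplusCapX_ge_kappa hW hCT hDT0 hκ0 hκ1 hs j) (surplusCapX_ge_of_exempt_kappa hW hCT hκ0 hκ1 hs hxa)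
  have hMpos : 0 < Mball ρ := by linarith
  have hbound : Mball ρ * Dfl R B e ≤ (DT - Dfl R B e) / Mball ρ := by
    rw [le_div_iff₀ hMpos]
    unfold CT₀ at hDT
    nlinarith
  unfold ballAvg
  linarith

/-- ★ Tight absorption with the exemption column and a general levy (`C_T ≥ C_T⁰`, `D_T ≥ 0`). [folklore] -/
theorem tightAbsorptionCapX_kappa {W : ℝ → ℝ} {R B e ρ CT DT D κT : ℝ} {ExM : SitePred} (hW : CutBounds W R B) (hρ : 0 ≤ ρ)
    (hCT : CT₀ R B e ρ ≤ CT) (hDT : 0 ≤ DT) (hκ0 : 0 ≤ κT) (hκ1 : κT ≤ 1) {N : ℕ} {y : Fin N → E3} (hs : Sep y) {i : Fin N}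
    (hT : TightNearCap ρ D y i) : 0 ≤ ballAvg ρ y (surplusCapX (1 / 20) (1 / 8) D W e κT CT DT ExM N y) i := by
  obtain ⟨a, ha, hga⟩ := hT
  have hD : 0 ≤ Dfl R B e := (Dfl_pos hW.range_nonneg hW.floor_nonneg).le
  have hDC := Dfl_le_CT₀ (e := e) hW.range_nonneg hW.floor_nonneg ρ
  have hCT0 : 0 ≤ CT := le_trans hD (hDC.trans hCT)
  have hM1 := one_le_Mball hρ
  have key := sum_div_ge_of_one_large (ball ρ y i) ha (surplusCapX (1 / 20) (1 / 8) D W e κT CT DT ExM N y)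
    (fun j => ((ball ρ y j).card : ℝ)) (L := CT - Dfl R B e) (M := Mball ρ) (D := Dfl R B e) (by linarith) hD
    (fun j _ => by exact_mod_cast one_le_card_ball hρ y j) (card_ball_le hρ hs a) (card_ball_le hρ hs i)
    (fun j _ => surplusCapX_ge_kappa hW hCT0 hDT hκ0 hκ1 hs j) (surplusCapX_ge_of_good_kappa hW hDT hκ0 hκ1 hs hga)
  have hMpos : 0 < Mball ρ := by linarith
  have hbound : Mball ρ * Dfl R B e ≤ (CT - Dfl R B e) / Mball ρ := by
    rw [le_div_iff₀ hMpos]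
    unfold CT₀ at hCT
    nlinarith
  unfold ballAvg
  linarith

/-- In a capped-tight-free and exempt-free ball both allowances are invisible (general levy). [folklore] -/
theorem ballAvg_surplusCapX_eq_of_free_kappa {W : ℝ → ℝ} {e ρ CT DT D κT : ℝ} {ExM : SitePred} {N : ℕ} {y : Fin N → E3} {i : Fin N}
    (hT : ¬TightNearCap ρ D y i) (hX : ¬ExemptNear ρ ExM y i) :
    ballAvg ρ y (surplusCapX (1 / 20) (1 / 8) D W e κT CT DT ExM N y) i = ballAvg ρ y (surplusCap (1 / 20) (1 / 8) D W e κT 0 N y) i := by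
  unfold ballAvg
  refine Finset.sum_congr rfl fun j hj => ?_
  have hng : ¬GoodAtScale (1 / 20) D y j := fun hg => hT ⟨j, hj, hg⟩
  have hnx : ¬ExM N y j := fun hx => hX ⟨j, hj, hx⟩
  simp only [surplusCapX, surplusCap, goodFlag, flag, if_neg hng, if_neg hnx, mul_zero, add_zero]

/-! ## §2. The census object and its pieces with the levy as a parameter -/

/-- **`EquilibriumMotifPricingCapK κ_T ρ ϱ D W e ExM`** — the census object of `…ExemptAbsorptionRecord` with the bad-site levy `κ_T` as a parameter. -/
def EquilibriumMotifPricingCapK (κT ρ ϱ D : ℝ) (W : ℝ → ℝ) (e : ℝ) (ExM : SitePred) : Prop :=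
  ∀ (M : ℕ) (z : Fin M → E3), Function.Injective z → Sep z → ∀ c : Fin M, (∀ a : Fin M, dist (z a) (z c) ≤ ϱ) →
    ¬TightNearCap ρ D z c → ¬ExemptNear ρ ExM z c → 0 ≤ ballAvg ρ z (surplusCap (1 / 20) (1 / 8) D W e κT 0 M z) c

/-- **Piece 1 with the levy as a parameter** (strained patch). -/
def StrainedPatchMotifPricingCapXK (κT ρ ϱ D : ℝ) (W : ℝ → ℝ) (e : ℝ) (ExM : SitePred) : Prop :=
  ∀ (M : ℕ) (z : Fin M → E3), Function.Injective z → Sep z → ∀ c : Fin M, (∀ a : Fin M, dist (z a) (z c) ≤ ϱ) →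
    ¬TightNearCap ρ D z c → ¬ExemptNear ρ ExM z c → ¬BadNearCap ρ D z c → 0 ≤ ballAvg ρ z (surplusCap (1 / 20) (1 / 8) D W e κT 0 M z) c

/-- **Piece 2 with the levy as a parameter** (crowded core). -/
def CrowdedCoreMotifPricingCapK (κT ρ ϱ D : ℝ) (W : ℝ → ℝ) (e : ℝ) (ExM : SitePred) : Prop :=
  ∀ (M : ℕ) (z : Fin M → E3), Function.Injective z → Sep z → ∀ c : Fin M, (∀ a : Fin M, dist (z a) (z c) ≤ ϱ) →
    ¬TightNearCap ρ D z c → ¬ExemptNear ρ ExM z c → BadNearCap ρ D z c → CrowdedNear ρ 13 z c →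
      0 ≤ ballAvg ρ z (surplusCap (1 / 20) (1 / 8) D W e κT 0 M z) c

/-- **Piece 3 with the levy as a parameter** (dilute defect). -/
def DiluteDefectMotifPricingCapK (κT ρ ϱ D : ℝ) (W : ℝ → ℝ) (e : ℝ) (ExM : SitePred) : Prop :=
  ∀ (M : ℕ) (z : Fin M → E3), Function.Injective z → Sep z → ∀ c : Fin M, (∀ a : Fin M, dist (z a) (z c) ≤ ϱ) →
    ¬TightNearCap ρ D z c → ¬ExemptNear ρ ExM z c → BadNearCap ρ D z c → ¬CrowdedNear ρ 13 z c →
      0 ≤ ballAvg ρ z (surplusCap (1 / 20) (1 / 8) D W e κT 0 M z) c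

/-- At `κ_T = 1/100` the parametric census object IS the record one (literally). [folklore] -/
theorem equilibriumMotifPricingCapK_centi {ρ ϱ D : ℝ} {W : ℝ → ℝ} {e : ℝ} {ExM : SitePred} :
    EquilibriumMotifPricingCapK (1 / 100) ρ ϱ D W e ExM ↔ EquilibriumMotifPricingCap ρ ϱ D W e ExM := Iff.rfl

/-- At `κ_T = 1/100` piece 1 IS the record piece. [folklore] -/
theorem strainedPatchMotifPricingCapXK_centi {ρ ϱ D : ℝ} {W : ℝ → ℝ} {e : ℝ} {ExM : SitePred} :
    StrainedPatchMotifPricingCapXK (1 / 100) ρ ϱ D W e ExM ↔ StrainedPatchMotifPricingCapX ρ ϱ D W e ExM := Iff.rfl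

/-- At `κ_T = 1/100` piece 2 IS the record piece. [folklore] -/
theorem crowdedCoreMotifPricingCapK_centi {ρ ϱ D : ℝ} {W : ℝ → ℝ} {e : ℝ} {ExM : SitePred} :
    CrowdedCoreMotifPricingCapK (1 / 100) ρ ϱ D W e ExM ↔ CrowdedCoreMotifPricingCap ρ ϱ D W e ExM := Iff.rfl

/-- At `κ_T = 1/100` piece 3 IS the record piece. [folklore] -/
theorem diluteDefectMotifPricingCapK_centi {ρ ϱ D : ℝ} {W : ℝ → ℝ} {e : ℝ} {ExM : SitePred} :
    DiluteDefectMotifPricingCapK (1 / 100) ρ ϱ D W e ExM ↔ DiluteDefectMotifPricingCap ρ ϱ D W e ExM := Iff.rfl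

/-- ★ The split is a case distinction (parametric levy). [folklore] -/
theorem equilibriumMotifPricingCapK_iff_pieces {κT ρ ϱ D : ℝ} {W : ℝ → ℝ} {e : ℝ} {ExM : SitePred} :
    EquilibriumMotifPricingCapK κT ρ ϱ D W e ExM ↔
      StrainedPatchMotifPricingCapXK κT ρ ϱ D W e ExM ∧ CrowdedCoreMotifPricingCapK κT ρ ϱ D W e ExM ∧
        DiluteDefectMotifPricingCapK κT ρ ϱ D W e ExM := by
  constructor
  · exact fun h => ⟨fun M z hz hs c hconf ht hx _ => h M z hz hs c hconf ht hx, fun M z hz hs c hconf ht hx _ _ => h M z hz hs c hconf ht hx,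
      fun M z hz hs c hconf ht hx _ _ => h M z hz hs c hconf ht hx⟩
  · rintro ⟨h1, h2, h3⟩ M z hz hs c hconf ht hx
    by_cases hb : BadNearCap ρ D z c
    · by_cases hc : CrowdedNear ρ 13 z c
      · exact h2 M z hz hs c hconf ht hx hb hc
      · exact h3 M z hz hs c hconf ht hx hb hc
    · exact h1 M z hz hs c hconf ht hx hb

/-- The capped surplus is ANTITONE in the levy: `κ_T′ ≤ κ_T ⟹ x_j(κ_T) ≤ x_j(κ_T′)`. [folklore] -/
theorem surplusCap_anti_kappa {η₀ η₁ D : ℝ} {W : ℝ → ℝ} {e κT κT' CT : ℝ} (hκ : κT' ≤ κT) {N : ℕ} (y : Fin N → E3) (j : Fin N) :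
    surplusCap η₀ η₁ D W e κT CT N y j ≤ surplusCap η₀ η₁ D W e κT' CT N y j := by
  unfold surplusCap
  have hg := goodFlag_mem (η := η₁) (D := D) y j
  nlinarith [mul_le_mul_of_nonneg_right hκ (sub_nonneg.2 hg.2)]

/-- ★ **MONOTONICITY IN THE LEVY**: a SMALLER levy gives a WEAKER census object (`κ_T′ ≤ κ_T`): re-filing at `1/125` only weakens the leaves. [folklore] -/
theorem equilibriumMotifPricingCapK_anti_kappa {κT κT' ρ ϱ D : ℝ} {W : ℝ → ℝ} {e : ℝ} {ExM : SitePred} (hκ : κT' ≤ κT)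
    (h : EquilibriumMotifPricingCapK κT ρ ϱ D W e ExM) : EquilibriumMotifPricingCapK κT' ρ ϱ D W e ExM :=
  fun M z hz hs c hconf ht hx => (h M z hz hs c hconf ht hx).trans (ballAvg_mono z (fun j => surplusCap_anti_kappa hκ z j) c)

/-! ## §3. Bridges and the node by name for every `0 < κ_T ≤ 1` -/

/-- ★ `C_T, D_T ≥ C_T⁰ ∧ EquilibriumMotifPricingCapK κ_T ⟹ X ball book on motifs` (`0 ≤ κ_T ≤ 1`, `ρ ≥ 0`). [folklore] -/
theorem ballAveragedMotifPricingCapX_of_equilibriumK {W : ℝ → ℝ} {R B e ρ ϱ CT DT D κT : ℝ} {ExM : SitePred} (hW : CutBounds W R B)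
    (hρ : 0 ≤ ρ) (hκ0 : 0 ≤ κT) (hκ1 : κT ≤ 1) (hCT : CT₀ R B e ρ ≤ CT) (hDT : CT₀ R B e ρ ≤ DT)
    (h : EquilibriumMotifPricingCapK κT ρ ϱ D W e ExM) : BallAveragedMotifPricingCapX ρ ϱ (1 / 20) (1 / 8) D W e κT CT DT ExM := by
  have hD : 0 ≤ Dfl R B e := (Dfl_pos hW.range_nonneg hW.floor_nonneg).le
  have hDC := Dfl_le_CT₀ (e := e) hW.range_nonneg hW.floor_nonneg ρ
  intro M z hz hs c hconf
  by_cases ht : TightNearCap ρ D z c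
  · exact tightAbsorptionCapX_kappa hW hρ hCT (hD.trans (hDC.trans hDT)) hκ0 hκ1 hs ht
  by_cases hx : ExemptNear ρ ExM z c
  · exact exemptAbsorptionCapX_kappa hW hρ (hD.trans (hDC.trans hCT)) hDT hκ0 hκ1 hs hx
  rw [ballAvg_surplusCapX_eq_of_free_kappa ht hx]
  exact h M z hz hs c hconf ht hx

/-- ★★ **`Topt♭-type pricing with levy κ_T ⟸ EquilibriumMotifPricingCapK κ_T at the collar exemption`** (side conditions of
`…CollarCensus.schurTopologicalPricingX_of_collarMotifCap`, plus `0 ≤ κ_T ≤ 1`). [folklore chaining] -/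
theorem schurTopologicalPricingX_of_collarMotifCapK {w ω : ℝ → ℝ} {A eUp R B R' ρ r ρ₁ ϱ D κT : ℝ} {ExM Ex : SitePred}
    (hWB : CutBounds (effPot w ω A) R B) (hW : ∀ t, R' ≤ t → effPot w ω A t = 0) (h0 : 0 ≤ ρ) (hr : 0 ≤ r) (h1 : 0 ≤ ρ₁) (hρ : ρ ≤ ρ₁ + r)
    (hR : R' ≤ ρ₁ + r) (hD : 13 / 10 * D + 1 ≤ ρ₁ + r) (hϱ : ρ + (ρ₁ + r) ≤ ϱ) (hEx : IsLocalFeature ρ₁ (flag ExM)) (hκ0 : 0 ≤ κT) (hκ1 : κT ≤ 1)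
    (hImp : ∀ (N : ℕ) (y : Fin N → E3), Function.Injective y → Sep y → ∀ j : Fin N, ExM N y j → Ex N y j)
    (h : EquilibriumMotifPricingCapK κT ρ ϱ D (effPot w ω A) (eUp + A) (Collar r ExM)) :
    SchurTopologicalPricingX (1 / 20) (1 / 8) w ω A eUp κT (CT₀ R B (eUp + A) ρ) (Mball r * CT₀ R B (eUp + A) ρ) Ex :=
  have hC : 0 ≤ CT₀ R B (eUp + A) ρ :=
    (Dfl_pos hWB.range_nonneg hWB.floor_nonneg).le.trans (Dfl_le_CT₀ hWB.range_nonneg hWB.floor_nonneg ρ)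
  schurTopologicalPricingX_of_ballAveragedMotifCapX_collar hW (by norm_num) (by norm_num) h0 hr hρ hR hD hϱ (flag_collar_isLocal h1 hEx)
    hκ0 hC hC hImp (ballAveragedMotifPricingCapX_of_equilibriumK hWB h0 hκ0 hκ1 le_rfl le_rfl h)

/-- ★★★ **THE COLLARED NODE BY NAME FOR EVERY LEVY `0 < κ_T ≤ 1`**: `MuEquilibriumDoor ∧ UP(−0.7175) ∧ Eopt♭₄₅(ε, ϱ′, 1; …) ∧
EquilibriumMotifPricingCapK κ_T ρ ϱ D W₄₅ e₄₅′ (CollarCore r (−0.7175) ε Rm s t) ⟹ AperiodicFrustratedLawGap` (side conditions of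
`…CollarCensus.aperiodicFrustratedLawGap_of_collarMotifCap`), through the κ-GENERIC door `…ExemptSplit.aperiodicFrustratedLawGap_of_split_locOpt_fourHalf`.
[folklore chaining] -/
theorem aperiodicFrustratedLawGap_of_collarMotifCapK {κT ρ r ρ₁ ϱ D ε Rm s t ϱ' CE DE DX : ℝ}
    (hDoor : Summit.AtomisticToContinuum.Crystallization.Theses.GrainCoreNetworkSplit.MuEquilibriumDoor)
    (hU : PeriodicEnergyCeiling (-(7175 / 10000))) (hε : 0 < ε) (hDX : 0 ≤ DX) (hE : EoptFourHalf ε ϱ' 1 CE DE DX)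
    (hκ0 : 0 < κT) (hκ1 : κT ≤ 1) (h0 : 0 ≤ ρ) (hr : 0 ≤ r) (h1 : 0 ≤ ρ₁) (hρ : ρ ≤ ρ₁ + r) (hR : 9 / 2 ≤ ρ₁ + r)
    (hD : 13 / 10 * D + 1 ≤ ρ₁ + r) (hRm : Rm ≤ ρ₁) (hϱ : ρ + (ρ₁ + r) ≤ ϱ) (hRm1 : 1 + s ≤ Rm) (hs0 : 0 ≤ s) (hs : s ≤ ϱ') (hεt : ε ≤ t)
    (h : EquilibriumMotifPricingCapK κT ρ ϱ D (effPot w₄₅ ω₄ (3 / 400)) (-(7175 / 10000) + 3 / 400) (CollarCore r (-(7175 / 10000)) ε Rm s t)) :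
    Summit.AtomisticToContinuum.Crystallization.Theses.FrustratedLawDichotomy.AperiodicFrustratedLawGap := by
  have hC : 0 ≤ CT₄₅ ρ :=
    (Dfl_pos W₄₅_cutBounds.range_nonneg W₄₅_cutBounds.floor_nonneg).le.trans
      (Dfl_le_CT₀ W₄₅_cutBounds.range_nonneg W₄₅_cutBounds.floor_nonneg ρ)
  have hM : 0 ≤ Mball r * CT₄₅ ρ := mul_nonneg (zero_le_one.trans (one_le_Mball hr)) hC
  have hUp : eStar ≤ -(7175 / 10000) := eStar_le_of_periodicEnergyCeiling hU
  have hT : SchurTopologicalPricingX (1 / 20) (1 / 8) w₄₅ ω₄ (3 / 400) (-(7175 / 10000)) κT (CT₄₅ ρ) (Mball r * CT₄₅ ρ)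
      (LocOptFails eStar ε ϱ' 1) := by
    unfold CollarCore at h
    exact schurTopologicalPricingX_of_collarMotifCapK W₄₅_cutBounds (fun _ ht => effPot_fourHalf_eq_zero _ ht) h0 hr h1 hρ hR hD hϱ
      (flag_nonEquilibriumCore_isLocal hRm) hκ0.le hκ1
      (fun _ _ _ hsep _ hx => locOptFails_of_nonEquilibriumCore hUp hRm1 hs0 hs hεt hsep hx) h
  exact aperiodicFrustratedLawGap_of_split_locOpt_fourHalf hDoor sf₄₅_holds hU hε hκ0 hM hT (by norm_num) hDX hE

/-- ★ **THE NODE IN THREE PIECES at the record literals and a general levy** `0 < κ_T ≤ 1`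
(`(ρ, D, r, ρ₁, ϱ, ε, Rm, s, t, ϱ′) = (9/5, 3/2, 9/2, 7, 133/10, 1/10000, 7, 1/20, 1/10000, 3/2)`):
`MuEquilibriumDoor ∧ UP(−0.7175) ∧ Eopt♭₄₅(1/10000, 3/2, 1; …) ∧ F1^X♯(κ_T) ∧ CC♯(κ_T) ∧ DD♯(κ_T) ⟹ AperiodicFrustratedLawGap`;
at `κ_T = 1/100` this is `…CollarCensus.aperiodicFrustratedLawGap_of_collarPieces_record` (`…_centi`). [folklore chaining] -/
theorem aperiodicFrustratedLawGap_of_collarPiecesK_record {κT CE DE DX : ℝ}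
    (hDoor : Summit.AtomisticToContinuum.Crystallization.Theses.GrainCoreNetworkSplit.MuEquilibriumDoor)
    (hU : PeriodicEnergyCeiling (-(7175 / 10000))) (hDX : 0 ≤ DX) (hE : EoptFourHalf (1 / 10000) (3 / 2) 1 CE DE DX)
    (hκ0 : 0 < κT) (hκ1 : κT ≤ 1)
    (h1 : StrainedPatchMotifPricingCapXK κT (9 / 5) (133 / 10) (3 / 2) (effPot w₄₅ ω₄ (3 / 400)) (-(7175 / 10000) + 3 / 400)
      (CollarCore (9 / 2) (-(7175 / 10000)) (1 / 10000) 7 (1 / 20) (1 / 10000)))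
    (h2 : CrowdedCoreMotifPricingCapK κT (9 / 5) (133 / 10) (3 / 2) (effPot w₄₅ ω₄ (3 / 400)) (-(7175 / 10000) + 3 / 400)
      (CollarCore (9 / 2) (-(7175 / 10000)) (1 / 10000) 7 (1 / 20) (1 / 10000)))
    (h3 : DiluteDefectMotifPricingCapK κT (9 / 5) (133 / 10) (3 / 2) (effPot w₄₅ ω₄ (3 / 400)) (-(7175 / 10000) + 3 / 400)
      (CollarCore (9 / 2) (-(7175 / 10000)) (1 / 10000) 7 (1 / 20) (1 / 10000))) :
    Summit.AtomisticToContinuum.Crystallization.Theses.FrustratedLawDichotomy.AperiodicFrustratedLawGap :=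
  aperiodicFrustratedLawGap_of_collarMotifCapK (ρ₁ := 7) hDoor hU (by norm_num) hDX hE hκ0 hκ1 (by norm_num) (by norm_num) (by norm_num)
    (by norm_num) (by norm_num) (by norm_num) le_rfl (by norm_num) (by norm_num) (by norm_num) (by norm_num) le_rfl
    (equilibriumMotifPricingCapK_iff_pieces.2 ⟨h1, h2, h3⟩)

/-- Sanity: the record node is the `κ_T = 1/100` instance (the parametric node applied to the record pieces). [folklore] -/
theorem aperiodicFrustratedLawGap_of_collarPieces_record' {CE DE DX : ℝ}
    (hDoor : Summit.AtomisticToContinuum.Crystallization.Theses.GrainCoreNetworkSplit.MuEquilibriumDoor)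
    (hU : PeriodicEnergyCeiling (-(7175 / 10000))) (hDX : 0 ≤ DX) (hE : EoptFourHalf (1 / 10000) (3 / 2) 1 CE DE DX)
    (h1 : StrainedPatchMotifPricingCapX (9 / 5) (133 / 10) (3 / 2) (effPot w₄₅ ω₄ (3 / 400)) (-(7175 / 10000) + 3 / 400)
      (CollarCore (9 / 2) (-(7175 / 10000)) (1 / 10000) 7 (1 / 20) (1 / 10000)))
    (h2 : CrowdedCoreMotifPricingCap (9 / 5) (133 / 10) (3 / 2) (effPot w₄₅ ω₄ (3 / 400)) (-(7175 / 10000) + 3 / 400)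
      (CollarCore (9 / 2) (-(7175 / 10000)) (1 / 10000) 7 (1 / 20) (1 / 10000)))
    (h3 : DiluteDefectMotifPricingCap (9 / 5) (133 / 10) (3 / 2) (effPot w₄₅ ω₄ (3 / 400)) (-(7175 / 10000) + 3 / 400)
      (CollarCore (9 / 2) (-(7175 / 10000)) (1 / 10000) 7 (1 / 20) (1 / 10000))) :
    Summit.AtomisticToContinuum.Crystallization.Theses.FrustratedLawDichotomy.AperiodicFrustratedLawGap :=
  aperiodicFrustratedLawGap_of_collarPiecesK_record (κT := 1 / 100) hDoor hU hDX hE (by norm_num) (by norm_num)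
    (strainedPatchMotifPricingCapXK_centi.2 h1) (crowdedCoreMotifPricingCapK_centi.2 h2) (diluteDefectMotifPricingCapK_centi.2 h3)

/-! ## §4. Both levies as parameters (critic row 586 (3): E-side re-file rule at `κ_E = 1/1250`) -/

/-- ★★ **THE COLLARED NODE BY NAME FOR EVERY PAIR OF LEVIES `0 < κ_T ≤ 1`, `0 < κ_E`**: as `aperiodicFrustratedLawGap_of_collarMotifCapK` but with the
E-side hypothesis in RAW form `SchurElasticPricingX (1/20) (1/8) W₄₅-data κ_E C_E D_E D_X (LocOptFails e⋆ ε ϱ′ 1)` (= `Eopt♭₄₅(ε, ϱ′, 1; …)` at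
`κ_E = 1/1000`), so that an E-side re-file is an instantiation too. [folklore chaining] -/
theorem aperiodicFrustratedLawGap_of_collarMotifCapKK {κT κE ρ r ρ₁ ϱ D ε Rm s t ϱ' CE DE DX : ℝ}
    (hDoor : Summit.AtomisticToContinuum.Crystallization.Theses.GrainCoreNetworkSplit.MuEquilibriumDoor)
    (hU : PeriodicEnergyCeiling (-(7175 / 10000))) (hε : 0 < ε) (hDX : 0 ≤ DX) (hκE : 0 < κE)
    (hE : SchurElasticPricingX (1 / 20) (1 / 8) w₄₅ ω₄ (3 / 400) (-(7175 / 10000)) κE CE DE DX (LocOptFails eStar ε ϱ' 1))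
    (hκ0 : 0 < κT) (hκ1 : κT ≤ 1) (h0 : 0 ≤ ρ) (hr : 0 ≤ r) (h1 : 0 ≤ ρ₁) (hρ : ρ ≤ ρ₁ + r) (hR : 9 / 2 ≤ ρ₁ + r)
    (hD : 13 / 10 * D + 1 ≤ ρ₁ + r) (hRm : Rm ≤ ρ₁) (hϱ : ρ + (ρ₁ + r) ≤ ϱ) (hRm1 : 1 + s ≤ Rm) (hs0 : 0 ≤ s) (hs : s ≤ ϱ') (hεt : ε ≤ t)
    (h : EquilibriumMotifPricingCapK κT ρ ϱ D (effPot w₄₅ ω₄ (3 / 400)) (-(7175 / 10000) + 3 / 400) (CollarCore r (-(7175 / 10000)) ε Rm s t)) :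
    Summit.AtomisticToContinuum.Crystallization.Theses.FrustratedLawDichotomy.AperiodicFrustratedLawGap := by
  have hC : 0 ≤ CT₄₅ ρ :=
    (Dfl_pos W₄₅_cutBounds.range_nonneg W₄₅_cutBounds.floor_nonneg).le.trans
      (Dfl_le_CT₀ W₄₅_cutBounds.range_nonneg W₄₅_cutBounds.floor_nonneg ρ)
  have hM : 0 ≤ Mball r * CT₄₅ ρ := mul_nonneg (zero_le_one.trans (one_le_Mball hr)) hC
  have hUp : eStar ≤ -(7175 / 10000) := eStar_le_of_periodicEnergyCeiling hU
  have hT : SchurTopologicalPricingX (1 / 20) (1 / 8) w₄₅ ω₄ (3 / 400) (-(7175 / 10000)) κT (CT₄₅ ρ) (Mball r * CT₄₅ ρ)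
      (LocOptFails eStar ε ϱ' 1) := by
    unfold CollarCore at h
    exact schurTopologicalPricingX_of_collarMotifCapK W₄₅_cutBounds (fun _ ht => effPot_fourHalf_eq_zero _ ht) h0 hr h1 hρ hR hD hϱ
      (flag_nonEquilibriumCore_isLocal hRm) hκ0.le hκ1
      (fun _ _ _ hsep _ hx => locOptFails_of_nonEquilibriumCore hUp hRm1 hs0 hs hεt hsep hx) h
  exact aperiodicFrustratedLawGap_of_split_locOpt_fourHalf hDoor sf₄₅_holds hU hε hκ0 hM hT hκE hDX hE

/-- ★ **THE NODE IN THREE PIECES at the record literals with BOTH levies as parameters** (`0 < κ_T ≤ 1`, `0 < κ_E`; E-side exemption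
`LocOptFails e⋆ (1/10000) (3/2) 1` as in the record). [folklore chaining] -/
theorem aperiodicFrustratedLawGap_of_collarPiecesKK_record {κT κE CE DE DX : ℝ}
    (hDoor : Summit.AtomisticToContinuum.Crystallization.Theses.GrainCoreNetworkSplit.MuEquilibriumDoor)
    (hU : PeriodicEnergyCeiling (-(7175 / 10000))) (hDX : 0 ≤ DX) (hκE : 0 < κE)
    (hE : SchurElasticPricingX (1 / 20) (1 / 8) w₄₅ ω₄ (3 / 400) (-(7175 / 10000)) κE CE DE DX (LocOptFails eStar (1 / 10000) (3 / 2) 1))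
    (hκ0 : 0 < κT) (hκ1 : κT ≤ 1)
    (h1 : StrainedPatchMotifPricingCapXK κT (9 / 5) (133 / 10) (3 / 2) (effPot w₄₅ ω₄ (3 / 400)) (-(7175 / 10000) + 3 / 400)
      (CollarCore (9 / 2) (-(7175 / 10000)) (1 / 10000) 7 (1 / 20) (1 / 10000)))
    (h2 : CrowdedCoreMotifPricingCapK κT (9 / 5) (133 / 10) (3 / 2) (effPot w₄₅ ω₄ (3 / 400)) (-(7175 / 10000) + 3 / 400)
      (CollarCore (9 / 2) (-(7175 / 10000)) (1 / 10000) 7 (1 / 20) (1 / 10000)))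
    (h3 : DiluteDefectMotifPricingCapK κT (9 / 5) (133 / 10) (3 / 2) (effPot w₄₅ ω₄ (3 / 400)) (-(7175 / 10000) + 3 / 400)
      (CollarCore (9 / 2) (-(7175 / 10000)) (1 / 10000) 7 (1 / 20) (1 / 10000))) :
    Summit.AtomisticToContinuum.Crystallization.Theses.FrustratedLawDichotomy.AperiodicFrustratedLawGap :=
  aperiodicFrustratedLawGap_of_collarMotifCapKK (ρ₁ := 7) hDoor hU (by norm_num) hDX hκE hE hκ0 hκ1 (by norm_num) (by norm_num) (by norm_num)
    (by norm_num) (by norm_num) (by norm_num) le_rfl (by norm_num) (by norm_num) (by norm_num) (by norm_num) le_rfl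
    (equilibriumMotifPricingCapK_iff_pieces.2 ⟨h1, h2, h3⟩)

end Summit.AtomisticToContinuum.Crystallization.Theorems.FrustratedLawDichotomyCollarCensusKappa

end
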